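/-
Copyright: rh-split cell (screw, bridge) gen 14, 2026-08-27.  Splitting search over kernel-typed
RH-equivalences; this module is ζ-free analysis.  Nothing here bears on the truth of RH.
-/
import Mathlib.Analysis.Complex.LocallyUniformLimit
import Mathlib.Analysis.Complex.CauchyIntegral
import Mathlib.Analysis.Analytic.Uniqueness
import Mathlib.Analysis.Normed.Module.Connected
import Mathlib.Analysis.Normed.Module.Ball.Homeomorph
import Mathlib.LinearAlgebra.Complex.FiniteDimensional
import Mathlib.Topology.Baire.Lemmas
import Mathlib.Topology.Baire.LocallyCompactRegular
import HarnessLib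

/-!
# Analytic continuation through an aliased pole field (ζ-free kernel of row X-9)

Data: an index type `ι`, coefficients `c : ι → ℂ` with `∑ ‖c i‖ < ∞` and `Re (c i) < 0`, and
non-zero `u : ι → ℂ`.  The BOREL SERIES of the data is

  `B(z) = ∑' i, c i · ((1/2)·((1 - u i z)⁻¹ + (1 - z/(u i))⁻¹) - (1 - z)⁻¹)`      (`term`)

(for `u i = e^{κᵢ h}` its Taylor coefficients at `0` are `∑ c i (cosh(κᵢ k h) - 1)`, i.e. lattice samples
of a cosh-series such as Suzuki's `Ψ`).  Its poles inside the unit disc form the INSIDE POLE SET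
`poleSet u = {p : ‖p‖ < 1, p = u i ∨ p = (u i)⁻¹}`; the total coefficient at a pole has negative real
part, so no pole can cancel.

**Main theorem** (`poleSet_eq_empty`).  If some `F`, complex-differentiable on the open unit disc,
agrees with `B` on a small disc `‖z‖ < r₀` free of poles (`r₀ ≤ ‖p‖` for every inside pole), and the
closure of the inside pole set is COUNTABLE inside the disc, then the inside pole set is EMPTY
(equivalently `‖u i‖ = 1` for all `i`, `norm_eq_one_of_countable_closure`).

Proof.  `B` is holomorphic on `V = 𝔻 ∖ closure(poleSet)` (locally uniform convergence); `V` is the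
unit disc minus a countable set, hence path-connected (`Set.Countable.isPathConnected_compl_of_one_lt_rank`
transported through `Homeomorph.unitBall`); the identity theorem gives `F = B` on `V`; by Baire's theorem
the countable compact set `closure(poleSet) ∩ closedBall 0 r` has an isolated point, which is then an
ISOLATED inside pole `p`; near `p`, `B = C_p·(1 - z/p)⁻¹ + (bounded)`, while `F` is bounded near `p`;
hence `C_p = 0`, contradicting `Re C_p < 0`.

**Walls theorem** (`not_mem_closure_of_isolated`, §7; countability-free).  Under the same agreement
hypothesis, an inside pole that is isolated in `closure(poleSet)` is adherent to NO preconnected set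
`V ∋ 0` inside `𝔻 ∖ closure(poleSet)`: the closure of the pole set must separate `0` from each of its
isolated points.  (Classical background: a Borel series extends meromorphically across each isolated
point of its pole set, and poles clustering on a whole separating curve are «an obvious necessary
condition» for Wolff-type cancellation — Ross–Shapiro, Generalized Analytic Continuation, Def. 4.2.1 and
§4.2; here the coefficients carry the sign `Re < 0`, so aliased coincidences cannot cancel either.)

RH-side reading (module `ScrewLatticeContinuation`): with Suzuki's data the dichotomy is
«lattice generating function of radius `1` ⟹ RH or the aliased pole field has uncountable closure
(Wolff-type walls)», i.e. the Wolff-packing obstruction B16 is not only sufficient but NECESSARY.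

No `sorry`, no new axioms, no instances, no notation.
-/

set_option linter.dupNamespace false

namespace Summit.RiemannHypothesis.RiemannHypothesis.Theorems.Splittings.ScrewBorel

open Complex Filter Topology Set Metric

/-! ## 1. The terms, the inside pole set, denominator bounds -/

/-- The Borel term with pole data `(c, u)`:
`term c u z = c · ((1/2)·((1 - u z)⁻¹ + (1 - z/u)⁻¹) - (1 - z)⁻¹)`. -/
noncomputable def term (c u z : ℂ) : ℂ :=
  c * ((1 / 2) * ((1 - u * z)⁻¹ + (1 - z / u)⁻¹) - (1 - z)⁻¹)

/-- The inside pole set of the data `u`: the points `u i`, `(u i)⁻¹` of norm `< 1`. -/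
def poleSet {ι : Type*} (u : ι → ℂ) : Set ℂ :=
  {p | ‖p‖ < 1 ∧ ∃ i, p = u i ∨ p = (u i)⁻¹}

/-- `‖w‖ ≤ r` gives `1 - r ≤ ‖1 - w‖`. -/
theorem one_sub_le_norm_one_sub {w : ℂ} {r : ℝ} (hw : ‖w‖ ≤ r) : 1 - r ≤ ‖1 - w‖ := by
  have h := norm_sub_norm_le (1 : ℂ) w
  rw [norm_one] at h
  linarith

/-- Denominator bound for `(1 - u z)⁻¹`: if `‖z‖ ≤ r`, `0 < δ ≤ 1 - r`, and `z` stays `δ`-away from the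
pole `u⁻¹` whenever that pole is inside the disc, then `δ ≤ ‖1 - u z‖`. -/
theorem le_norm_one_sub_mul {u z : ℂ} (hu : u ≠ 0) {r δ : ℝ} (hδr : δ ≤ 1 - r)
    (hz : ‖z‖ ≤ r) (hfar : ‖u⁻¹‖ < 1 → δ ≤ ‖u⁻¹ - z‖) : δ ≤ ‖1 - u * z‖ := by
  rcases le_or_gt ‖u‖ 1 with hu1 | hu1
  · have : ‖u * z‖ ≤ r := by
      rw [norm_mul]
      calc ‖u‖ * ‖z‖ ≤ 1 * r := by gcongr
        _ = r := one_mul r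
    exact hδr.trans (one_sub_le_norm_one_sub this)
  · have hinv : ‖u⁻¹‖ < 1 := by rw [norm_inv]; exact inv_lt_one_of_one_lt₀ hu1
    have h := hfar hinv
    have hfac : 1 - u * z = u * (u⁻¹ - z) := by field_simp
    rw [hfac, norm_mul]
    calc δ ≤ ‖u⁻¹ - z‖ := h
      _ = 1 * ‖u⁻¹ - z‖ := (one_mul _).symm
      _ ≤ ‖u‖ * ‖u⁻¹ - z‖ := by gcongr
  
/-- Denominator bound for `(1 - z/u)⁻¹`: if `‖z‖ ≤ r`, `δ ≤ 1 - r`, and `z` stays `δ`-away from the pole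
`u` whenever `‖u‖ < 1`, then `δ ≤ ‖1 - z/u‖`. -/
theorem le_norm_one_sub_div {u z : ℂ} (hu : u ≠ 0) {r δ : ℝ} (hδr : δ ≤ 1 - r)
    (hz : ‖z‖ ≤ r) (hfar : ‖u‖ < 1 → δ ≤ ‖u - z‖) : δ ≤ ‖1 - z / u‖ := by
  rcases lt_or_ge ‖u‖ 1 with hu1 | hu1
  · have h := hfar hu1
    have hupos : 0 < ‖u‖ := norm_pos_iff.2 hu
    have hfac : 1 - z / u = u⁻¹ * (u - z) := by field_simp
    rw [hfac, norm_mul, norm_inv]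
    calc δ ≤ ‖u - z‖ := h
      _ = 1 * ‖u - z‖ := (one_mul _).symm
      _ ≤ ‖u‖⁻¹ * ‖u - z‖ := by gcongr; exact (one_le_inv₀ hupos).2 hu1.le
  · have : ‖z / u‖ ≤ r := by
      rw [norm_div]
      calc ‖z‖ / ‖u‖ ≤ ‖z‖ / 1 := by gcongr
        _ ≤ r := by rw [div_one]; exact hz
    exact hδr.trans (one_sub_le_norm_one_sub this)

/-- `δ ≤ ‖w‖`, `0 < δ` give `‖w⁻¹‖ ≤ δ⁻¹`. -/
theorem norm_inv_le_of_le {w : ℂ} {δ : ℝ} (hδ : 0 < δ) (h : δ ≤ ‖w‖) : ‖w⁻¹‖ ≤ δ⁻¹ := by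
  rw [norm_inv]; exact inv_anti₀ hδ h

/-- Uniform bound and differentiability of one term away from its poles: with `‖z‖ ≤ r`,
`0 < δ ≤ 1 - r`, and `z` `δ`-away from the inside poles of this term, `‖term c u z‖ ≤ 2‖c‖/δ`. -/
theorem norm_term_le {c u z : ℂ} (hu : u ≠ 0) {r δ : ℝ} (hδ : 0 < δ) (hδr : δ ≤ 1 - r)
    (hz : ‖z‖ ≤ r) (hfar₁ : ‖u⁻¹‖ < 1 → δ ≤ ‖u⁻¹ - z‖) (hfar₂ : ‖u‖ < 1 → δ ≤ ‖u - z‖) :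
    ‖term c u z‖ ≤ 2 * ‖c‖ / δ := by
  have h1 := norm_inv_le_of_le hδ (le_norm_one_sub_mul hu hδr hz hfar₁)
  have h2 := norm_inv_le_of_le hδ (le_norm_one_sub_div hu hδr hz hfar₂)
  have h3 := norm_inv_le_of_le hδ (hδr.trans (one_sub_le_norm_one_sub hz))
  unfold term
  rw [norm_mul]
  have hin : ‖(1 / 2 : ℂ) * ((1 - u * z)⁻¹ + (1 - z / u)⁻¹) - (1 - z)⁻¹‖ ≤ 2 / δ := by
    calc ‖(1 / 2 : ℂ) * ((1 - u * z)⁻¹ + (1 - z / u)⁻¹) - (1 - z)⁻¹‖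
        ≤ ‖(1 / 2 : ℂ) * ((1 - u * z)⁻¹ + (1 - z / u)⁻¹)‖ + ‖(1 - z)⁻¹‖ := norm_sub_le _ _
      _ ≤ (1 / 2) * (δ⁻¹ + δ⁻¹) + δ⁻¹ := by
          gcongr
          rw [norm_mul]
          have : ‖(1 / 2 : ℂ)‖ = 1 / 2 := by simp
          rw [this]
          gcongr
          exact (norm_add_le _ _).trans (add_le_add h1 h2)
      _ = 2 / δ := by ring
  calc ‖c‖ * ‖(1 / 2 : ℂ) * ((1 - u * z)⁻¹ + (1 - z / u)⁻¹) - (1 - z)⁻¹‖ ≤ ‖c‖ * (2 / δ) := by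
        gcongr
    _ = 2 * ‖c‖ / δ := by ring

/-- Differentiability of one term at a point where its three denominators do not vanish. -/
theorem differentiableAt_term {c u z : ℂ} (h1 : 1 - u * z ≠ 0) (h2 : 1 - z / u ≠ 0)
    (h3 : 1 - z ≠ 0) : DifferentiableAt ℂ (fun w ↦ term c u w) z := by
  unfold term
  have d1 : DifferentiableAt ℂ (fun w : ℂ ↦ (1 - u * w)⁻¹) z :=
    ((differentiableAt_const _).sub ((differentiableAt_const _).mul differentiableAt_id)).inv h1
  have d2 : DifferentiableAt ℂ (fun w : ℂ ↦ (1 - w / u)⁻¹) z :=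
    ((differentiableAt_const _).sub (differentiableAt_id.div_const u)).inv h2
  have d3 : DifferentiableAt ℂ (fun w : ℂ ↦ (1 - w)⁻¹) z :=
    ((differentiableAt_const _).sub differentiableAt_id).inv h3
  exact (differentiableAt_const c).mul ((((differentiableAt_const _).mul (d1.add d2))).sub d3)

/-! ## 2. The Borel series is holomorphic off the closure of the inside pole set -/

/-- Local data at a point of `V = ball 0 1 ∖ closure (poleSet u)`: a radius `δ > 0` and `r < 1` with
`ball z₀ δ ⊆ closedBall 0 r`, `δ ≤ 1 - r`, and every inside pole `δ`-away from `ball z₀ δ`. -/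
theorem exists_local_gap {ι : Type*} {u : ι → ℂ} {z₀ : ℂ} (hz₀ : z₀ ∈ ball (0 : ℂ) 1)
    (hz₀' : z₀ ∉ closure (poleSet u)) :
    ∃ δ r : ℝ, 0 < δ ∧ δ ≤ 1 - r ∧ (∀ z ∈ ball z₀ δ, ‖z‖ ≤ r) ∧
      ∀ z ∈ ball z₀ δ, ∀ p ∈ poleSet u, δ ≤ ‖p - z‖ := by
  rw [Metric.mem_closure_iff] at hz₀'
  push Not at hz₀'
  obtain ⟨ε₁, hε₁, hfar⟩ := hz₀'
  rw [mem_ball_zero_iff] at hz₀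
  refine ⟨min (ε₁ / 2) ((1 - ‖z₀‖) / 4), ‖z₀‖ + min (ε₁ / 2) ((1 - ‖z₀‖) / 4),
    lt_min (by linarith) (by linarith), ?_, ?_, ?_⟩
  · have := min_le_right (ε₁ / 2) ((1 - ‖z₀‖) / 4)
    linarith
  · intro z hz
    rw [mem_ball] at hz
    have h' : ‖z‖ ≤ ‖z₀‖ + dist z z₀ := by
      rw [dist_eq_norm]
      have e : z₀ + (z - z₀) = z := by ring
      have := norm_add_le z₀ (z - z₀)
      rwa [e] at this
    linarith
  · intro z hz p hp
    rw [mem_ball] at hz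
    have h1 := hfar p hp
    have h2 : dist z₀ p ≤ dist z₀ z + dist z p := dist_triangle _ _ _
    rw [dist_comm z₀ z] at h2
    have h3 : dist z p = ‖p - z‖ := by rw [dist_comm, dist_eq_norm]
    have h4 := min_le_left (ε₁ / 2) ((1 - ‖z₀‖) / 4)
    linarith

/-- **`B` is complex-differentiable on `ball 0 1 ∖ closure (poleSet u)`.** -/
theorem differentiableOn_borel {ι : Type*} {c u : ι → ℂ} (hc : Summable fun i ↦ ‖c i‖)
    (hu : ∀ i, u i ≠ 0) :
    DifferentiableOn ℂ (fun z ↦ ∑' i, term (c i) (u i) z) (ball 0 1 \ closure (poleSet u)) := by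
  intro z₀ hz₀
  obtain ⟨δ, r, hδ, hδr, hzr, hfar⟩ := exists_local_gap hz₀.1 hz₀.2
  have hpole₁ : ∀ z ∈ ball z₀ δ, ∀ i, ‖(u i)⁻¹‖ < 1 → δ ≤ ‖(u i)⁻¹ - z‖ :=
    fun z hz i hi ↦ hfar z hz _ ⟨hi, i, Or.inr rfl⟩
  have hpole₂ : ∀ z ∈ ball z₀ δ, ∀ i, ‖u i‖ < 1 → δ ≤ ‖u i - z‖ :=
    fun z hz i hi ↦ hfar z hz _ ⟨hi, i, Or.inl rfl⟩
  have hdiff : DifferentiableOn ℂ (fun z ↦ ∑' i, term (c i) (u i) z) (ball z₀ δ) := by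
    refine differentiableOn_tsum_of_summable_norm (u := fun i ↦ 2 * ‖c i‖ / δ)
      ((hc.mul_left 2).div_const δ) (fun i z hz ↦ ?_) isOpen_ball (fun i z hz ↦ ?_)
    · have e1 := le_norm_one_sub_mul (hu i) hδr (hzr z hz) (hpole₁ z hz i)
      have e2 := le_norm_one_sub_div (hu i) hδr (hzr z hz) (hpole₂ z hz i)
      have e3 := hδr.trans (one_sub_le_norm_one_sub (hzr z hz))
      have n1 : 1 - u i * z ≠ 0 := fun h ↦ by rw [h, norm_zero] at e1; linarith
      have n2 : 1 - z / u i ≠ 0 := fun h ↦ by rw [h, norm_zero] at e2; linarith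
      have n3 : 1 - z ≠ 0 := fun h ↦ by rw [h, norm_zero] at e3; linarith
      exact (differentiableAt_term n1 n2 n3).differentiableWithinAt
    · exact norm_term_le (hu i) hδ hδr (hzr z hz) (hpole₁ z hz i) (hpole₂ z hz i)
  exact (hdiff.differentiableAt (ball_mem_nhds z₀ hδ)).differentiableWithinAt

/-! ## 3. `V = ball 0 1 ∖ closure (poleSet u)` is path-connected when the closure is countable in the
disc; the identity theorem -/

/-- The open unit disc minus a set whose trace on the disc is countable is path-connected (transport of
`Set.Countable.isPathConnected_compl_of_one_lt_rank` through `Homeomorph.unitBall`). -/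
theorem isPathConnected_ball_diff {E : Set ℂ} (hE : (E ∩ ball 0 1).Countable) :
    IsPathConnected (ball (0 : ℂ) 1 \ E) := by
  set e : ℂ ≃ₜ ball (0 : ℂ) 1 := Homeomorph.unitBall
  set g : ℂ → ℂ := fun x ↦ ((e x : ball (0 : ℂ) 1) : ℂ) with hg
  have hg_inj : Function.Injective g := fun x y hxy ↦ e.injective (Subtype.ext hxy)
  have hg_cont : Continuous g := continuous_subtype_val.comp e.continuous
  have hg_mem : ∀ x, g x ∈ ball (0 : ℂ) 1 := fun x ↦ (e x).2
  set A : Set ℂ := g ⁻¹' (E ∩ ball 0 1) with hA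
  have hAc : A.Countable := hE.preimage hg_inj
  have hpc : IsPathConnected Aᶜ :=
    Set.Countable.isPathConnected_compl_of_one_lt_rank (by simp [Complex.rank_real_complex]) hAc
  have himage : g '' Aᶜ = ball (0 : ℂ) 1 \ E := by
    ext y
    constructor
    · rintro ⟨x, hx, rfl⟩
      refine ⟨hg_mem x, fun hy ↦ hx ?_⟩
      exact ⟨hy, hg_mem x⟩
    · rintro ⟨hy, hyE⟩
      refine ⟨e.symm ⟨y, hy⟩, ?_, ?_⟩
      · intro hx
        rw [hA, mem_preimage, hg] at hx
        simp only [Homeomorph.apply_symm_apply] at hx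
        exact hyE hx.1
      · simp [hg]
  rw [← himage]
  exact hpc.image hg_cont

/-- **Identity theorem on `V`.**  If `F` is differentiable on the unit disc and agrees with the Borel series
on a pole-free disc `ball 0 r₀` (`0 < r₀ ≤ ‖p‖` for all inside poles), and the closure of the inside pole
set is countable in the disc, then `F = B` on `V = ball 0 1 ∖ closure (poleSet u)`. -/
theorem eqOn_borel {ι : Type*} {c u : ι → ℂ} (hc : Summable fun i ↦ ‖c i‖) (hu : ∀ i, u i ≠ 0)
    {F : ℂ → ℂ} (hF : DifferentiableOn ℂ F (ball 0 1)) {r₀ : ℝ} (hr₀ : 0 < r₀)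
    (hS : ∀ p ∈ poleSet u, r₀ ≤ ‖p‖)
    (hFB : EqOn F (fun z ↦ ∑' i, term (c i) (u i) z) (ball 0 r₀))
    (hcount : (closure (poleSet u) ∩ ball 0 1).Countable) :
    EqOn F (fun z ↦ ∑' i, term (c i) (u i) z) (ball 0 1 \ closure (poleSet u)) := by
  have hVopen : IsOpen (ball (0 : ℂ) 1 \ closure (poleSet u)) := isOpen_ball.sdiff isClosed_closure
  have hFan : AnalyticOnNhd ℂ F (ball 0 1 \ closure (poleSet u)) :=
    (hF.mono Set.sdiff_subset).analyticOnNhd hVopen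
  have hBan : AnalyticOnNhd ℂ (fun z ↦ ∑' i, term (c i) (u i) z) (ball 0 1 \ closure (poleSet u)) :=
    (differentiableOn_borel hc hu).analyticOnNhd hVopen
  -- the closure of the pole set stays outside `ball 0 r₀`
  have hclos : closure (poleSet u) ⊆ {q : ℂ | r₀ ≤ ‖q‖} :=
    closure_minimal (fun p hp ↦ hS p hp) (isClosed_le continuous_const continuous_norm)
  have h0 : (0 : ℂ) ∈ ball (0 : ℂ) 1 \ closure (poleSet u) := by
    refine ⟨mem_ball_self one_pos, fun h ↦ ?_⟩
    have := hclos h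
    simp only [mem_setOf_eq, norm_zero] at this
    linarith
  have hev : F =ᶠ[𝓝 0] fun z ↦ ∑' i, term (c i) (u i) z :=
    Filter.eventuallyEq_of_mem (ball_mem_nhds 0 hr₀) hFB
  exact hFan.eqOn_of_preconnected_of_eventuallyEq hBan
    (isPathConnected_ball_diff hcount).isConnected.isPreconnected h0 hev

/-! ## 4. Baire: a non-empty inside pole set with countable closure has an ISOLATED pole -/

/-- If the inside pole set is non-empty and its closure is countable in the disc, some inside pole `p`
is isolated in the closure: for some `ε > 0` with `‖p‖ + 2ε < 1`, every point of `closure (poleSet u)`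
within `2ε` of `p` equals `p`. -/
theorem exists_isolated_pole {ι : Type*} {u : ι → ℂ} (hne : (poleSet u).Nonempty)
    (hcount : (closure (poleSet u) ∩ ball 0 1).Countable) :
    ∃ p ∈ poleSet u, ∃ ε : ℝ, 0 < ε ∧ ‖p‖ + 2 * ε < 1 ∧
      ∀ q ∈ closure (poleSet u), ‖q - p‖ < 2 * ε → q = p := by
  classical
  obtain ⟨p₀, hp₀⟩ := hne
  have hp₀1 : ‖p₀‖ < 1 := hp₀.1
  set r : ℝ := (‖p₀‖ + 1) / 2 with hr
  have hr1 : r < 1 := by rw [hr]; linarith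
  have hp₀r : ‖p₀‖ < r := by rw [hr]; linarith
  set K : Set ℂ := closure (poleSet u) ∩ closedBall 0 r with hK
  have hKclosed : IsClosed K := isClosed_closure.inter isClosed_closedBall
  have hKsub : K ⊆ closure (poleSet u) ∩ ball 0 1 := by
    intro q hq
    refine ⟨hq.1, ?_⟩
    have := hq.2
    rw [mem_closedBall_zero_iff] at this
    exact mem_ball_zero_iff.2 (this.trans_lt hr1)
  have hKc : K.Countable := hcount.mono hKsub
  have hp₀K : p₀ ∈ K := ⟨subset_closure hp₀, mem_closedBall_zero_iff.2 hp₀r.le⟩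
  -- Baire in the subtype `K` (closed in the locally compact space `ℂ`)
  haveI : Countable K := hKc.to_subtype
  haveI : LocallyCompactSpace K := hKclosed.locallyCompactSpace
  have hcov : (⋃ x : K, ({x} : Set K)) = univ := iUnion_of_singleton K
  have hdense : Dense (⋃ x : K, interior ({x} : Set K)) :=
    dense_iUnion_interior_of_closed (fun x ↦ isClosed_singleton) hcov
  -- the open set `{‖·‖ < r}` of `K` is non-empty (it contains `p₀`)
  set O : Set K := {x : K | ‖(x : ℂ)‖ < r} with hO
  have hOopen : IsOpen O := isOpen_lt (continuous_norm.comp continuous_subtype_val) continuous_const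
  have hOne : O.Nonempty := ⟨⟨p₀, hp₀K⟩, hp₀r⟩
  obtain ⟨x, hxD, hxO⟩ := hdense.exists_mem_open hOopen hOne
  rw [mem_iUnion] at hxD
  obtain ⟨x₁, hx₁⟩ := hxD
  have hxx₁ : x ∈ ({x₁} : Set K) := interior_subset hx₁
  rw [mem_singleton_iff] at hxx₁
  subst hxx₁
  -- `{x}` is a neighbourhood of `x` in `K`: pull back to a ball in `ℂ`
  have hnhds : ({x} : Set K) ∈ 𝓝 x := mem_interior_iff_mem_nhds.1 hx₁
  rw [mem_nhds_subtype] at hnhds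
  obtain ⟨U, hU, hUsub⟩ := hnhds
  obtain ⟨ε₀, hε₀, hball⟩ := Metric.mem_nhds_iff.1 hU
  -- isolate: `q ∈ K`, `dist q x < ε₀` ⇒ `q = x`
  have hiso : ∀ q ∈ K, dist q (x : ℂ) < ε₀ → q = x := by
    intro q hqK hq
    have hq' : (⟨q, hqK⟩ : K) ∈ Subtype.val ⁻¹' U := hball (mem_ball.2 hq)
    have := hUsub hq'
    rw [mem_singleton_iff] at this
    exact congrArg Subtype.val this
  have hxr : ‖(x : ℂ)‖ < r := hxO
  -- choose `ε` with `2ε ≤ ε₀`, `‖x‖ + 2ε < r`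
  set ε : ℝ := min (ε₀ / 2) ((r - ‖(x : ℂ)‖) / 4) with hε
  have hεpos : 0 < ε := lt_min (by linarith) (by linarith)
  have hε₁ : 2 * ε ≤ ε₀ := by have := min_le_left (ε₀ / 2) ((r - ‖(x : ℂ)‖) / 4); linarith
  have hε₂ : ‖(x : ℂ)‖ + 2 * ε < r := by
    have := min_le_right (ε₀ / 2) ((r - ‖(x : ℂ)‖) / 4); linarith
  -- `x` itself is an inside pole: it is in the closure, and the only nearby closure point
  have hxcl : (x : ℂ) ∈ closure (poleSet u) := x.2.1
  have hnear : ∀ q ∈ closure (poleSet u), ‖q - (x : ℂ)‖ < 2 * ε → q = x := by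
    intro q hq hqx
    have hqr : q ∈ closedBall (0 : ℂ) r := by
      rw [mem_closedBall_zero_iff]
      have e : (x : ℂ) + (q - x) = q := by ring
      have := norm_add_le (x : ℂ) (q - x)
      rw [e] at this
      linarith
    exact hiso q ⟨hq, hqr⟩ (by rw [dist_eq_norm]; linarith)
  have hxS : (x : ℂ) ∈ poleSet u := by
    obtain ⟨b, hb, hbx⟩ := Metric.mem_closure_iff.1 hxcl ε hεpos
    have hb' : b = x := hnear b (subset_closure hb) (by rw [dist_comm, dist_eq_norm] at hbx; linarith)
    rw [← hb']; exact hb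
  exact ⟨x, hxS, ε, hεpos, by linarith, hnear⟩

end Summit.RiemannHypothesis.RiemannHypothesis.Theorems.Splittings.ScrewBorel
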